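import Summits.ValiantsHypothesis.ValiantsHypothesis.Theorems.DivisionGapPerDivisionHardStubCellContentRigid
import Literature.Barriers.ValiantsHypothesis.MonotoneGapParseTrees
import Summits.ValiantsHypothesis.ValiantsHypothesis.Theorems.DivisionGapPerDivisionHardStubTorusFamily

/-!
# Crux `DivisionGap.PerDivisionHard` (stmt-ValiantsHypothesis-5065), line `pair-descent-jss-endpoint` —
stub `stub_cellContentRigidFamily`: ONE placement rigid for every PRODUCT of low-rank factors (column mode)

The family form of `stub_cellContentRigid` (`Theorems/DivisionGapPerDivisionHardStubCellContentRigid.lean`).  There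
the union bound ran over the pairs of `Y`-column contents of ONE polynomial `h`; but the placement it produces only
depends on the finite SET `V` of admissible column-content vectors, and the twins it excludes are LOCAL: if
`h = ∏_i f_i` is a product of torus-homogeneous factors whose monomials all have `Y`-column contents in `V`, then the
top fibre of `h` under the generic cut is `∏_i top(f_i)` (`topComponent_mul`), every factor's top support agrees off
the face (otherwise the product's would not), and two distinct elements of ONE factor's top support differ by a
nonzero circulation of the placed graph — whose `Y`-column-sums are detected by the splits (`stub_splitFlow`) on
`≥ k - 1` core (live) columns: a bad pair of values of `V`, excluded by the count.  So the SAME placement makes every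
such product rigid, although the product itself may have huge rank (`|V|^s`).

`stub_cellContentRigidFamily`: for all `c d` and all large `n`, every cell set `Y` with at least `n/8` live columns and
every set `V` of at most `2^{(log₂ n+c)^c}` column-content vectors admit a placement `eR eC` of `G(b,k) ⊕ M₀` with
`b ≥ (log₂ n+d)^d` such that for EVERY nonzero torus-homogeneous product `∏_i f_i` of torus-homogeneous factors with
`colContent_Y(supp f_i) ⊆ V` there are a weight `w` cutting out the placed face and a single `G`-part of its top-`w`
fibre.  (Examples: `h_bal = ∏_i (Σ_j x_ij · row-ρ₀ compensation)` — each factor has `≤ n` contents — so the two handles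
of the line, prices and rank, meet on it; products of arbitrarily many `f(x_Y)·g(x_Yᶜ)`-sums of width `≤ 2^B`.)
-/

noncomputable section

-- `Summit.ValiantsHypothesis.ValiantsHypothesis.…` is the tree's mandated single-conjunct layout
-- (Sub = Summit), so the duplicated namespace component is intended.
set_option linter.dupNamespace false

namespace Summit.ValiantsHypothesis.ValiantsHypothesis.Theorems.DivisionGapPerDivisionHard

open MvPolynomial Literature.Computability.AlgebraicComplexity
open Summit.ValiantsHypothesis.ValiantsHypothesis.Theorems.ZeroOneTransfer.Negative
open scoped NNReal Pointwise BigOperators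

variable {n : ℕ}

-- `topComponent_finset_prod` (top of a finite product = product of tops) comes from the landed
-- `Theorems/DivisionGapPerDivisionHardStubTorusFamily.lean`.

/-- Over `ℝ≥0` (no zero divisors, no cancellation) the monomials of a finite product are exactly the sums of
monomials of the factors. [folklore] -/
theorem mem_support_finset_prod_iff {ι : Type*} [DecidableEq ι] (S : Finset ι)
    (p : ι → MvPolynomial (Fin n × Fin n) ℝ≥0) (m : (Fin n × Fin n) →₀ ℕ) :
    m ∈ (∏ i ∈ S, p i).support ↔
      ∃ g : ι → (Fin n × Fin n) →₀ ℕ, (∀ i ∈ S, g i ∈ (p i).support) ∧ ∑ i ∈ S, g i = m := by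
  classical
  induction S using Finset.induction_on generalizing m with
  | empty =>
    simp only [Finset.prod_empty, Finset.notMem_empty, IsEmpty.forall_iff, implies_true, true_and,
      Finset.sum_empty]
    rw [show (1 : MvPolynomial (Fin n × Fin n) ℝ≥0) = monomial 0 1 from rfl, support_monomial,
      if_neg one_ne_zero, Finset.mem_singleton]
    constructor
    · intro h; exact ⟨fun _ => 0, h.symm⟩
    · rintro ⟨_, h⟩; exact h.symm
  | insert a S ha ih =>
    rw [Finset.prod_insert ha, Literature.Barriers.ValiantsHypothesis.JerrumSnir.support_mul_eq, Finset.mem_add]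
    constructor
    · rintro ⟨x, hx, y, hy, rfl⟩
      obtain ⟨g, hg, rfl⟩ := (ih y).mp hy
      refine ⟨Function.update g a x, fun i hi => ?_, ?_⟩
      · rcases Finset.mem_insert.mp hi with rfl | hi
        · rwa [Function.update_self]
        · rw [Function.update_of_ne (ne_of_mem_of_not_mem hi ha)]
          exact hg i hi
      · rw [Finset.sum_insert ha, Function.update_self, Finset.sum_update_of_notMem ha]
    · rintro ⟨g, hg, rfl⟩
      rw [Finset.sum_insert ha]
      exact ⟨g a, hg a (Finset.mem_insert_self a S), ∑ i ∈ S, g i,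
        (ih _).mpr ⟨g, fun i hi => hg i (Finset.mem_insert_of_mem hi), rfl⟩, rfl⟩

/-- Every monomial of one factor extends, by a FIXED tail, to a monomial of the (nonzero) product. [folklore] -/
theorem exists_tail_of_mem_support_prod {ι : Type*} [DecidableEq ι] (S : Finset ι)
    (p : ι → MvPolynomial (Fin n × Fin n) ℝ≥0) (hne : ∀ i ∈ S, p i ≠ 0) (i₀ : ι) (hi₀ : i₀ ∈ S) :
    ∃ y : (Fin n × Fin n) →₀ ℕ, ∀ x ∈ (p i₀).support, x + y ∈ (∏ i ∈ S, p i).support := by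
  classical
  have hch : ∀ i ∈ S.erase i₀, ((p i).support).Nonempty := fun i hi =>
    support_nonempty.mpr (hne i (Finset.mem_of_mem_erase hi))
  -- one monomial in every other factor
  let g : ι → (Fin n × Fin n) →₀ ℕ := fun i => if hi : i ∈ S.erase i₀ then (hch i hi).choose else 0
  have hg : ∀ i ∈ S.erase i₀, g i ∈ (p i).support := fun i hi => by
    simp only [g, dif_pos hi]
    exact (hch i hi).choose_spec
  refine ⟨∑ i ∈ S.erase i₀, g i, fun x hx => ?_⟩
  rw [← Finset.mul_prod_erase S p hi₀, Literature.Barriers.ValiantsHypothesis.JerrumSnir.support_mul_eq]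
  exact Finset.add_mem_add hx ((mem_support_finset_prod_iff _ _ _).mpr ⟨g, hg, rfl⟩)

/-- **`stub_cellContentRigidFamily` (one placement for all products of low-rank factors; column mode).**  For all `c d` there is `n₀` such that for `n ≥ n₀`
every nonzero torus-homogeneous `h ∈ ℝ≥0[x_ij]` whose monomials have at most `2^{(log₂ n + c)^c}` distinct
`Y`-column-content vectors `(Σ_{r : (r,c) ∈ Y} m(r,c))_c`, for a cell set `Y` with at least `n/8` live
columns (more than `n/64` cells in `Y` and more than `n/64` outside), admits a placement `eR eC` of
`G(b,k) ⊕ M₀` with `(log₂ n + d)^d ≤ b`, a weight `w` cutting out the placed face, and a single `G`-part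
`u` of the top-`w` fibre of `h`.  Core columns by counting inside the live columns, rows greedy
(`stub_greedyRows`), generic weight, splits detect circulations (`stub_splitFlow`). [folklore] -/
theorem stub_cellContentRigidFamily :
    ∀ c d : ℕ, ∃ n₀ : ℕ, ∀ n ≥ n₀, ∀ (Y : Finset (Fin n × Fin n)) (V : Finset (Fin n → ℕ)),
      n ≤ 8 * (Finset.univ.filter fun c : Fin n =>
          n / 64 < (Finset.univ.filter fun r : Fin n => (r, c) ∈ Y).card ∧
          n / 64 < (Finset.univ.filter fun r : Fin n => (r, c) ∉ Y).card).card →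
      V.card ≤ 2 ^ ((Nat.log 2 n + c) ^ c) →
      ∃ (b k m : ℕ) (eR eC : BlockV b k m ≃ Fin n), (Nat.log 2 n + d) ^ d ≤ b ∧
        ∀ (s : ℕ) (f : Fin s → MvPolynomial (Fin n × Fin n) ℝ≥0),
          ∏ i, f i ≠ 0 → IsTorusHomogeneous (∏ i, f i) → (∀ i, IsTorusHomogeneous (f i)) →
          (∀ i, ((f i).support.image fun (mm : (Fin n × Fin n) →₀ ℕ) (cc : Fin n) =>
              ∑ r ∈ Finset.univ.filter (fun r : Fin n => (r, cc) ∈ Y), mm (r, cc)) ⊆ V) →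
          ∃ (w : Fin n × Fin n → ℕ) (u : (Fin n × Fin n) →₀ ℕ),
            CutsOut w (placedBlock eR eC) ∧ HasSingleGPart (placedBlock eR eC) w (∏ i, f i) u := by
  intro c d
  obtain ⟨L₀, hL₀⟩ := growth256 (c + d)
  refine ⟨2 ^ (L₀ + 1), fun n hn Y V hlive hcard => ?_⟩
  classical
  -- the parameters
  have hn0 : n ≠ 0 := by
    have : 1 ≤ 2 ^ (L₀ + 1) := Nat.one_le_two_pow
    omega
  have hLL₀ : L₀ + 1 ≤ Nat.log 2 n := Nat.le_log_of_pow_le one_lt_two hn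
  have h2L : 2 ^ Nat.log 2 n ≤ n := Nat.pow_log_le_self 2 hn0
  have hq256 := hL₀ (Nat.log 2 n) (by omega)
  set L := Nat.log 2 n with hL
  have hy : 2 ≤ L + (c + d) + 1 := by omega
  have hdq : (L + d) ^ d ≤ (L + (c + d) + 1) ^ (c + d + 5) :=
    (Nat.pow_le_pow_left (by omega) d).trans (Nat.pow_le_pow_right (by omega) (by omega))
  have hq2 : 2 ≤ (L + (c + d) + 1) ^ (c + d + 5) :=
    (Nat.le_self_pow (by omega) 2).trans (Nat.pow_le_pow_left hy _)
  have h2c : 2 * (L + c) ^ c ≤ (L + (c + d) + 1) ^ (c + d + 5) :=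
    calc 2 * (L + c) ^ c ≤ (L + (c + d) + 1) * (L + (c + d) + 1) ^ c :=
          Nat.mul_le_mul hy (Nat.pow_le_pow_left (by omega) c)
      _ = (L + (c + d) + 1) ^ (c + 1) := by ring
      _ ≤ (L + (c + d) + 1) ^ (c + d + 5) := Nat.pow_le_pow_right (by omega) (by omega)
  set q := (L + (c + d) + 1) ^ (c + d + 5) with hq
  obtain ⟨h4N, h2N⟩ := four_mul_coreCount_le q hq2
  set N := q + q * (q * (q + 1)) with hN
  have h64N : 64 * N ≤ n := le_trans (by omega) (hq256.trans h2L)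
  have hNdiv : N ≤ n / 64 := (Nat.le_div_iff_mul_le (by norm_num)).mpr (by omega)
  have hk : 0 < q + 1 := Nat.succ_pos q
  -- the live columns
  set LC := (Finset.univ.filter fun cc : Fin n =>
      n / 64 < (Finset.univ.filter fun r : Fin n => (r, cc) ∈ Y).card ∧
      n / 64 < (Finset.univ.filter fun r : Fin n => (r, cc) ∉ Y).card) with hLC
  have hLCcard : 32 * (q * (q * q)) ≤ LC.card := by omega
  -- the column-content map and the bad pairs of its values (live part of the difference set)
  set colY : ((Fin n × Fin n) →₀ ℕ) → (Fin n → ℕ) := fun mm cc =>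
    ∑ r ∈ Finset.univ.filter (fun r : Fin n => (r, cc) ∈ Y), mm (r, cc) with hcolY
  let T : (Fin n → ℕ) × (Fin n → ℕ) → Finset (Fin n) := fun p =>
    Finset.univ.filter fun cc => p.1 cc ≠ p.2 cc
  let T' : (Fin n → ℕ) × (Fin n → ℕ) → Finset {cc // cc ∈ LC} := fun p =>
    (T p).subtype fun cc => cc ∈ LC
  set P := (V ×ˢ V).filter fun p => q ≤ (T' p).card with hP
  have hPcard : P.card ≤ 2 ^ q :=
    calc P.card ≤ (V ×ˢ V).card := Finset.card_filter_le _ _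
      _ = V.card * V.card := Finset.card_product _ _
      _ ≤ 2 ^ ((L + c) ^ c) * 2 ^ ((L + c) ^ c) := Nat.mul_le_mul hcard hcard
      _ = 2 ^ (2 * (L + c) ^ c) := by rw [two_mul, pow_add]
      _ ≤ 2 ^ q := Nat.pow_le_pow_right two_pos h2c
  -- a good set of `N` LIVE core columns
  obtain ⟨R', hR'card, hR'good⟩ := exists_goodSubset P T' N q
    (fun p hp => (Finset.mem_filter.mp hp).2)
    (by rw [Fintype.card_coe]; exact count_lt (by omega) (by omega) hPcard (by omega))
  set S : Finset (Fin n) := R'.map (Function.Embedding.subtype _) with hS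
  have hScard : S.card = N := by rw [hS, Finset.card_map, hR'card]
  have hSlive : ∀ cc ∈ S, cc ∈ LC := by
    intro cc hcc
    rw [hS, Finset.mem_map] at hcc
    obtain ⟨x, -, rfl⟩ := hcc
    exact x.2
  -- the greedy placement: columns inside `S`, rows splitting every internal column
  have hSgreedy : ∀ cc ∈ S, N < (Finset.univ.filter fun r : Fin n => (r, cc) ∈ Y).card ∧
      N < (Finset.univ.filter fun r : Fin n => (r, cc) ∉ Y).card := by
    intro cc hcc
    have hl := (Finset.mem_filter.mp (hSlive cc hcc)).2
    exact ⟨lt_of_le_of_lt hNdiv hl.1, lt_of_le_of_lt hNdiv hl.2⟩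
  obtain ⟨eR, eC, heC₁, heC₂, hsplit⟩ :=
    stub_greedyRows q (q + 1) (n - N) n Y S hScard (by omega) hSgreedy
  refine ⟨q, q + 1, n - N, eR, eC, hdq, fun s f hh htor htori hV => ?_⟩
  set G := placedBlock eR eC with hG
  set h := ∏ i, f i with hhdef
  set B := h.totalDegree + 1 with hB
  have hfne : ∀ i ∈ (Finset.univ : Finset (Fin s)), f i ≠ 0 := fun i _ h0 =>
    hh (Finset.prod_eq_zero (Finset.mem_univ i) h0)
  -- the generic weight cuts out `G`
  obtain ⟨g, hg⟩ := exists_blockMatching q (q + 1) (n - N) hk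
  obtain ⟨σ₀, hσ₀⟩ := exists_perm_mem_placedBlock eR eC g hg
  have hcut : CutsOut (genericWeight G B) G := cutsOut_genericWeight G (Nat.succ_pos _) σ₀ hσ₀
  -- the top fibre of the product is the product of the factors' top fibres
  have htop : topComponent (genericWeight G B) h = ∏ i, topComponent (genericWeight G B) (f i) :=
    topComponent_finset_prod _ _ _
  have htopne : ∀ i ∈ (Finset.univ : Finset (Fin s)), topComponent (genericWeight G B) (f i) ≠ 0 :=
    fun i hi => topComponent_ne_zero _ (hfne i hi)
  -- the whole top fibre agrees off `G`
  have hoffAll : ∀ m₁ ∈ (topComponent (genericWeight G B) h).support,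
      ∀ m₂ ∈ (topComponent (genericWeight G B) h).support, ∀ e ∉ G, m₁ e = m₂ e := by
    intro m₁ hm₁ m₂ hm₂
    have hs₁ := support_topComponent_subset _ h hm₁
    have hs₂ := support_topComponent_subset _ h hm₂
    obtain ⟨r₀, c₀, hrc⟩ := htor
    exact eq_offG_of_mem_support_topComponent G hm₁ hm₂
      (degree_eq_of_rowDegrees_eq ((hrc m₁ hs₁).1.trans (hrc m₂ hs₂).1.symm))
  -- hence every FACTOR's top support agrees off `G`
  have hoffFac : ∀ i, ∀ x ∈ (topComponent (genericWeight G B) (f i)).support,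
      ∀ x' ∈ (topComponent (genericWeight G B) (f i)).support, ∀ e ∉ G, x e = x' e := by
    intro i x hx x' hx' e he
    obtain ⟨y, hy⟩ := exists_tail_of_mem_support_prod (Finset.univ : Finset (Fin s))
      (fun j => topComponent (genericWeight G B) (f j)) htopne i (Finset.mem_univ i)
    have h1 : x + y ∈ (topComponent (genericWeight G B) h).support := by rw [htop]; exact hy x hx
    have h2 : x' + y ∈ (topComponent (genericWeight G B) h).support := by rw [htop]; exact hy x' hx'
    have := hoffAll _ h1 _ h2 e he
    simpa using this
  -- every factor's top support is a single monomial
  have hfibFac : ∀ i, ∀ x ∈ (topComponent (genericWeight G B) (f i)).support,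
      ∀ x' ∈ (topComponent (genericWeight G B) (f i)).support, x = x' := by
    intro i m₁ hm₁ m₂ hm₂
    have hs₁ := support_topComponent_subset _ (f i) hm₁
    have hs₂ := support_topComponent_subset _ (f i) hm₂
    obtain ⟨r₀, c₀, hrc⟩ := htori i
    have hoff := hoffFac i m₁ hm₁ m₂ hm₂
    by_contra hne
    -- the difference `D = m₁ - m₂`: supported on `G`, vanishing margins, nonzero
    obtain ⟨hrow, hcol⟩ := sum_diff_eq_zero ((hrc m₁ hs₁).1.trans (hrc m₂ hs₂).1.symm)
      ((hrc m₁ hs₁).2.trans (hrc m₂ hs₂).2.symm)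
    set D : Fin n × Fin n → ℤ := fun e => (m₁ e : ℤ) - m₂ e with hD
    have hDG : ∀ e, D e ≠ 0 → e ∈ G := fun e he => by
      by_contra heG
      exact he (by simp only [hD, hoff e heG, sub_self])
    have hDne : ∃ e, D e ≠ 0 := by
      by_contra hall
      push Not at hall
      exact hne (Finsupp.ext fun e => by exact_mod_cast sub_eq_zero.mp (hall e))
    obtain ⟨hcols, hnotpad⟩ :=
      stub_splitFlow q (q + 1) (n - N) n eR eC Y D hk hDG hrow hcol hsplit hDne
    -- the two column contents: their difference set is the set of columns with nonzero `Y`-sum …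
    have hTeq : T (colY m₁, colY m₂) = Finset.univ.filter fun cc =>
        ∑ r ∈ Finset.univ.filter (fun r : Fin n => (r, cc) ∈ Y), D (r, cc) ≠ 0 := by
      refine Finset.filter_congr fun cc _ => ?_
      change (∑ r ∈ Finset.univ.filter (fun r : Fin n => (r, cc) ∈ Y), m₁ (r, cc) ≠
        ∑ r ∈ Finset.univ.filter (fun r : Fin n => (r, cc) ∈ Y), m₂ (r, cc)) ↔ _
      rw [← colContent_sub_eq_sum _ m₁ m₂ cc, sub_ne_zero, Nat.cast_injective.ne_iff]
    -- … all of which are core columns, hence in `S` (live)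
    have hTS : T (colY m₁, colY m₂) ⊆ S := by
      intro cc hcc
      rw [hTeq] at hcc
      have hcc' := (Finset.mem_filter.mp hcc).2
      obtain ⟨x, rfl⟩ := eC.surjective cc
      rcases x with i' | p | u
      · exact heC₁ i'
      · exact heC₂ p
      · exact absurd (eC.symm_apply_apply _) (hnotpad _ u hcc')
    -- so the pair is bad, and its live part lies inside `R'`: excluded by the choice of `R'`
    have hT'card : q ≤ (T' (colY m₁, colY m₂)).card := by
      have hc : (T' (colY m₁, colY m₂)).card = (T (colY m₁, colY m₂)).card := by
        change ((T (colY m₁, colY m₂)).subtype fun cc => cc ∈ LC).card = _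
        rw [Finset.card_subtype, Finset.filter_true_of_mem fun cc hcc => hSlive cc (hTS hcc)]
      rw [hc, hTeq]
      simpa only [Nat.add_sub_cancel] using hcols
    have hmem : (colY m₁, colY m₂) ∈ P :=
      Finset.mem_filter.mpr ⟨Finset.mk_mem_product (hV i (Finset.mem_image_of_mem _ hs₁))
        (hV i (Finset.mem_image_of_mem _ hs₂)), hT'card⟩
    refine hR'good _ hmem fun x hx => ?_
    have hxT : (x : Fin n) ∈ T (colY m₁, colY m₂) := by
      change x ∈ (T (colY m₁, colY m₂)).subtype (fun cc => cc ∈ LC) at hx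
      exact (Finset.mem_subtype.mp hx)
    have hxS := hTS hxT
    rw [hS, Finset.mem_map] at hxS
    obtain ⟨y, hy, hyx⟩ := hxS
    have : y = x := Subtype.ext (by simpa using hyx)
    exact this ▸ hy
  -- hence the product's top fibre is a single monomial
  have hfib : ∀ m₁ ∈ (topComponent (genericWeight G B) h).support,
      ∀ m₂ ∈ (topComponent (genericWeight G B) h).support, m₁ = m₂ := by
    intro m₁ hm₁ m₂ hm₂
    rw [htop] at hm₁ hm₂
    obtain ⟨g₁, hg₁, rfl⟩ := (mem_support_finset_prod_iff _ _ _).mp hm₁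
    obtain ⟨g₂, hg₂, rfl⟩ := (mem_support_finset_prod_iff _ _ _).mp hm₂
    exact Finset.sum_congr rfl fun i hi => hfibFac i _ (hg₁ i hi) _ (hg₂ i hi)
  -- conclusion: `u` is the `G`-part of the unique monomial of the top fibre
  obtain ⟨m₀, hm₀⟩ := support_nonempty.mpr (topComponent_ne_zero (genericWeight G B) hh)
  refine ⟨genericWeight G B, m₀.filter (· ∈ G), hcut, fun e he => ?_, fun m' hm' e he => ?_⟩
  · rw [Finsupp.support_filter] at he
    exact (Finset.mem_filter.mp he).2
  · rw [hfib m' hm' m₀ hm₀, Finsupp.filter_apply_pos _ _ he]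

end Summit.ValiantsHypothesis.ValiantsHypothesis.Theorems.DivisionGapPerDivisionHard

end
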